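import Literature.NumberTheory.EllipticCurves.TunnellFormsCuspidalProofs
import Literature.NumberTheory.EllipticCurves.TunnellThetaCoefficients
import Literature.NumberTheory.EllipticCurves.CongruentNumberCurveLValueTen
import Literature.NumberTheory.EllipticCurves.BSDAnalyticRankTunnellWaldspurgerLValuesProofs
import HarnessLib

/-!
# Tunnell's leaves `Tunnell1983_a/b_sq_propto_L_one` from Waldspurger's Corollaire 2 and Theorem 2

Sibling proof file of `CongruentNumberCurveRootNumber(Even)` (the named facts
`Literature.NumberTheory.EllipticCurves.Tunnell1983_a_sq_propto_L_one`,
`Literature.NumberTheory.EllipticCurves.Tunnell1983_b_sq_propto_L_one`: on each odd class modulo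
`8`, `a(n)² = c · L(Eⁿ, 1) √n`, resp. `b(n)² = c · L(E²ⁿ, 1) √n`, for square-free `n` — the
displays of Tunnell 1983, p. 329) and of `TunnellHalfIntegralForms` (`Tunnell1983_waldspurger_triv`,
`Tunnell1983_waldspurger_chi2`, equivalent to them by `Tunnell1983_waldspurger_*_iff_propto`).
After the work recorded in `TunnellFormsCuspidalProofs`, `CongruentNumberCurveLValueTwo/Ten` and
`BSDAnalyticRankTunnellWaldspurgerLValuesProofs`, these two leaves are the ONLY unproved input of
both directions of Tunnell's theorem in the tree (`tunnell_even/odd`, `tunnell_converse_even/odd`,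
`Tunnell1983_L_one_even/odd`). This file pins down, in Lean and against the tree's definitions,
the exact published statement behind them and PROVES the passage:

**Waldspurger 1981, Corollaire 2 (p. 379; Purkait 2013, Cor. 5.2), at `N = 128`, `k = 3`.**
"Let `φ ∈ S_{k-1}^{new}(M_φ, χ²)` be a newform satisfying (H1). Suppose
`f = ∑ aₙ qⁿ ∈ S_{k/2}(N, χ, φ)` for some `N ≥ 1` such that `M_φ ∣ N/2`. Suppose `n₁, n₂` are
positive square-free integers such that `n₁/n₂ ∈ (ℚ_p^×)²` for all `p ∣ N`. Then
`a_{n₁}² L(φ χ₀⁻¹ χ_{n₂}, 1) χ(n₂/n₁) n₂^{k/2-1} = a_{n₂}² L(φ χ₀⁻¹ χ_{n₁}, 1) n₁^{k/2-1}`",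
where `χ₀(n) = χ(n) (-1/n)^{(k-1)/2}` and `χ_t = (t/·)`. Here: `k = 3`, `N = 128`, `φ` = the
newform of weight `2`, level `M_φ = 32 ∣ 64` and trivial character ((H1) holds for trivial
character, Vignéras; Purkait Thm 6), `χ = χ₂ = (2/·)` (resp. `χ = 1`); the only prime dividing
`N` is `2`, and for odd `n₁, n₂`: `n₁/n₂ ∈ (ℚ₂^×)² ⟺ n₁ ≡ n₂ (mod 8)`, whence `χ(n₂/n₁) = 1`;
`χ₀⁻¹ χ_n = χ₂ χ₋₄ χ_n` is the character of `ℚ(√(-2n))` (resp. `χ₋₄ χ_n`, of `ℚ(√(-n))`), and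
`L(φ ⊗ χ_{-2n}, s) = L(E⁽⁻²ⁿ⁾, s) = L(E₂ₙ, s)` (resp. `L(φ ⊗ χ₋ₙ, s) = L(Eₙ, s)`), because the
quadratic twist of `E : y² = x³ - x` by `d` is `y² = x³ - d²x = congruentNumberCurve |d|` and
`E⁽⁻ᵈ⁾ ≅ E⁽ᵈ⁾` (`x ↦ -x`) — exactly as Tunnell reads it: "`A(t)² = L(φ χ₋₁ χ_t, 1) = L(Eᵗ, 1)`"
(p. 329, l. 8) and "`A(t)² = L(φ χ₂ χ_t, 1) = L(E²ᵗ, 1)`" (p. 329, l. 23). The space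
`S_{3/2}(128, χ, φ)` is the tree's `tunnellSubspace χ = shimuraSubspace 3 128 χ (a_p(E))`
(Tunnell p. 328 (ii); it omits Shimura's restriction to the Petersson complement of the unary
theta series — see the review note on `shimuraSubspace` in `HalfIntegralWeightForms` — so the
hypothesis below, which quantifies over `tunnellSubspace χ`, is Corollaire 2 composed with that
standing identification, as in the facts `Tunnell1983_thm2_*`).

Main results (no definitions, no new named facts; the corollary enters as an explicit hypothesis,
stated inline with the guards `HasEntireLFunction` of the tree's `L(E_m, 1)`):

* `Tunnell1983_b_sq_propto_L_one_of_thm2_of_waldspurgerCor` — **Corollaire 2 (`χ = χ₂`) and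
  Theorem 2 (`g θ₄ ∈ S_{3/2}(128, χ₂, φ)`, the fact `Tunnell1983_thm2_chi2`) imply
  `Tunnell1983_b_sq_propto_L_one`**, with the constants `c₁ = 1/L(E₂, 1) = 2√2/β` and
  `c₅ = b(5)²/(L(E₁₀, 1) √5) = 2√2/β` FIXED by the tree's theorems `L(E₂, 1) = β/(2√2)`,
  `L(E₁₀, 1) = 2β/√10` (`CongruentNumberCurveLValueTwo/Ten`) and `b(1) = 1`, `b(5) = 2`: apply
  the corollary to `f = g θ₄` and the pairs `(n, 1)`, `(n, 5)`;
* `Tunnell1983_a_sq_propto_L_one_of_thm2_of_waldspurgerCor` — the same for the trivial character: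
  Corollaire 2 (`χ = 1`) and `Tunnell1983_thm2_triv` (`g θ₂ ∈ S_{3/2}(128, 1, φ)`) imply
  `Tunnell1983_a_sq_propto_L_one` (pairs `(n, 1)`, `(n, 3)`; `L(E₁, 1) = β/4`, `L(E₃, 1) = β/√3`,
  `a(1) = 1`, `a(3) = 2`);
* the consequences one step up, by the tree's reductions: `Tunnell1983_waldspurger_chi2/triv_of_…`
  (the Waldspurger-shaped leaves of `TunnellHalfIntegralForms`), `Tunnell1983_L_one_even/odd_of_…`
  (**Theorem 3**), `tunnell_converse_even/odd_of_…` (bsd.S29, converse direction).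

So, in the tree, **Tunnell's theorem now rests on exactly two published statements: Theorem 2
(`Tunnell1983_thm2_chi2/triv`, itself reduced in `TunnellThmTwoHeckeProofs` to the Cohen–Oesterlé
dimension count and the Shimura–Niwa identification) and Waldspurger's Corollaire 2 at level
`128`** — the latter a theorem about the Shimura correspondence whose known proofs (Waldspurger
1981 via the theta correspondence; Kohnen–Zagier 1981 / Kohnen 1985 for level `4N`, `N` odd
square-free, which excludes `N = 32`; Gross 1987 for prime level; Baruch–Mao 2007 in general) all
require the Rankin–Selberg method or the theta correspondence, absent from Mathlib and the tree.

## References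

* J.-L. Waldspurger, *Sur les coefficients de Fourier des formes modulaires de poids demi-entier*,
  J. Math. Pures Appl. 60 (1981) 375–484, Thm 1 and Corollaire 2. [Waldspurger1981Fourier]
* S. Purkait, *Explicit application of Waldspurger's theorem*, LMS J. Comput. Math. 16 (2013)
  216–245 (arXiv:1208.4329), §2 (Shimura decomposition), Thm 7 (Waldspurger), Cor. 5.2
  (held: `paper:arxiv-1208.4329`, pp. 5, 9–10 of the materialised text).
* J. B. Tunnell, *A classical Diophantine problem and modular forms of weight 3/2*, Invent. Math.
  72 (1983) 323–334: Theorem (Waldspurger) p. 328, proof of Thm 3 p. 329. [Tunnell1983Congruent]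
-/

noncomputable section

open Complex

namespace Literature.NumberTheory.EllipticCurves

open Tunnell1983 ModularForms

/-! ### Coefficients of `g θ₂`, `g θ₄` at odd arguments -/

/-- `qCoeffs (g θ₄) n = b(n)` for odd `n` (Tunnell p. 328, `g θ₄ = ∑ b(n) qⁿ`).
[cite: Tunnell1983Congruent, p. 328] -/
theorem qCoeffs_tunnellForm_four_of_odd {n : ℕ} (hn : Odd n) :
    qCoeffs (tunnellForm 4) n = (Tunnell1983.b n : ℂ) := by
  rw [qCoeffs_tunnellForm_eq_gThetaCoeff (by norm_num), b_eq_gThetaCoeff hn]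
  push_cast
  rfl

/-- `qCoeffs (g θ₂) n = a(n)` for odd `n` (Tunnell p. 328, `g θ₂ = ∑ a(n) qⁿ`).
[cite: Tunnell1983Congruent, p. 328] -/
theorem qCoeffs_tunnellForm_two_of_odd {n : ℕ} (hn : Odd n) :
    qCoeffs (tunnellForm 2) n = (Tunnell1983.a n : ℂ) := by
  rw [qCoeffs_tunnellForm_eq_gThetaCoeff two_pos, a_eq_gThetaCoeff hn]
  push_cast
  rfl

/-- `Squarefree (2n)` for odd square-free `n`. [folklore] -/
theorem squarefree_two_mul_of_odd {n : ℕ} (hn : Squarefree n) (hodd : Odd n) :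
    Squarefree (2 * n) :=
  (Nat.squarefree_mul (Nat.coprime_two_left.mpr hodd)).2 ⟨Nat.prime_two.prime.squarefree, hn⟩

/-- The four CM `L`-values used on p. 329 are non-zero: `L(E₂, 1) = β/(2√2) ≠ 0`. [folklore] -/
theorem entireLFunction_congruentNumberCurve_two_one_ne_zero :
    (congruentNumberCurve 2).entireLFunction 1 ≠ 0 := by
  rw [entireLFunction_congruentNumberCurve_two_one, Complex.ofReal_ne_zero]
  have := tunnellPeriod_pos
  positivity

/-- `L(E₁₀, 1) = 2β/√10 ≠ 0`. [folklore] -/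
theorem entireLFunction_congruentNumberCurve_ten_one_ne_zero :
    (congruentNumberCurve 10).entireLFunction 1 ≠ 0 := by
  rw [entireLFunction_congruentNumberCurve_ten_one, Complex.ofReal_ne_zero]
  have := tunnellPeriod_pos
  positivity

/-- `L(E₁, 1) = β/4 ≠ 0`. [folklore] -/
theorem entireLFunction_congruentNumberCurve_one_one_ne_zero :
    (congruentNumberCurve 1).entireLFunction 1 ≠ 0 := by
  rw [entireLFunction_congruentNumberCurve_one_one, Complex.ofReal_ne_zero]
  have := tunnellPeriod_pos
  positivity

/-- `L(E₃, 1) = β/√3 ≠ 0`. [folklore] -/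
theorem entireLFunction_congruentNumberCurve_three_one_ne_zero :
    (congruentNumberCurve 3).entireLFunction 1 ≠ 0 := by
  rw [BirchSwinnertonDyer1965_L_one_one_three_holds.2
    (hasEntireLFunction_congruentNumberCurve_holds Nat.prime_three.prime.squarefree),
    Complex.ofReal_ne_zero]
  have := tunnellPeriod_pos
  positivity

/-! ### Character `χ₂`: `Tunnell1983_b_sq_propto_L_one` from Corollaire 2 and Theorem 2 -/

/-- **Waldspurger's Corollaire 2 at `N = 128`, `k = 3`, `χ = χ₂`, `φ` of level `32`, combined with
Tunnell's Theorem 2 (`g θ₄ ∈ S_{3/2}(128, χ₂, φ)`), gives the displays of p. 329 for `b(n)`**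
(`Tunnell1983_b_sq_propto_L_one`, with `c₁ = c₅ = 2√2/β`). The hypothesis `hW` is Corollaire 2
for this `(N, k, χ, φ)` restricted to odd square-free `n₁ ≡ n₂ (mod 8)` (the square-class
condition at the unique prime `2 ∣ N`; `χ₂(n₂/n₁) = 1`), with `L(φ χ₀⁻¹ χ_n, 1) = L(E₂ₙ, 1)` the
tree's `entireLFunction 1` of `congruentNumberCurve (2 n)` under its guard. Proof: apply `hW` to
`f = g θ₄` (in `S_{3/2}(128, χ₂, φ)` by `h2`) and the pairs `(n, 1)`, `(n, 5)`, and use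
`b(1) = 1`, `b(5) = 2`, `L(E₂, 1) ≠ 0`, `L(E₁₀, 1) ≠ 0`.
[cite: Waldspurger1981Fourier, Corollaire 2] [cite: Tunnell1983Congruent, p. 328 (Theorem
(Waldspurger)) and p. 329, ll. 22–27] -/
theorem Tunnell1983_b_sq_propto_L_one_of_thm2_of_waldspurgerCor (h2 : Tunnell1983_thm2_chi2)
    (hW : ∀ f ∈ tunnellSubspace tunnellChar, ∀ ⦃n₁ n₂ : ℕ⦄, Odd n₁ → Squarefree n₁ →
      Squarefree n₂ → n₁ % 8 = n₂ % 8 →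
      (congruentNumberCurve (2 * n₁)).HasEntireLFunction →
      (congruentNumberCurve (2 * n₂)).HasEntireLFunction →
      qCoeffs f n₁ ^ 2 * (congruentNumberCurve (2 * n₂)).entireLFunction 1 * (Real.sqrt n₂ : ℂ) =
        qCoeffs f n₂ ^ 2 * (congruentNumberCurve (2 * n₁)).entireLFunction 1 *
          (Real.sqrt n₁ : ℂ)) :
    Tunnell1983_b_sq_propto_L_one := by
  have hsq2 : Squarefree (2 * 1) := by rw [Nat.mul_one]; exact Nat.prime_two.prime.squarefree
  have hsq10 : Squarefree (2 * 5) :=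
    squarefree_two_mul_of_odd Nat.prime_five.prime.squarefree (by decide)
  have hL2 := entireLFunction_congruentNumberCurve_two_one_ne_zero
  have hL10 := entireLFunction_congruentNumberCurve_ten_one_ne_zero
  refine ⟨((congruentNumberCurve 2).entireLFunction 1)⁻¹,
    4 * ((congruentNumberCurve 10).entireLFunction 1 * (Real.sqrt 5 : ℂ))⁻¹, fun n hn hL ↦ ⟨?_, ?_⟩⟩
  · intro h1
    have hodd : Odd n := Nat.odd_iff.mpr (by omega)
    have key := hW (tunnellForm 4) h2.1 hodd hn squarefree_one (by omega) hL
      (hasEntireLFunction_congruentNumberCurve_holds hsq2)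
    rw [qCoeffs_tunnellForm_four_of_odd hodd, qCoeffs_tunnellForm_four_of_odd odd_one, b_one,
      Nat.mul_one, Nat.cast_one, Real.sqrt_one] at key
    push_cast at key
    rw [one_pow, one_mul, mul_one] at key
    rw [mul_assoc, ← key]
    field_simp
  · intro h5
    have hodd : Odd n := Nat.odd_iff.mpr (by omega)
    have key := hW (tunnellForm 4) h2.1 hodd hn Nat.prime_five.prime.squarefree (by omega)
      hL (hasEntireLFunction_congruentNumberCurve_holds hsq10)
    rw [qCoeffs_tunnellForm_four_of_odd hodd, qCoeffs_tunnellForm_four_of_odd (by decide),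
      b_five, show (2 * 5 : ℕ) = 10 from rfl] at key
    push_cast at key
    have hs5 : (Real.sqrt 5 : ℂ) ≠ 0 := Complex.ofReal_ne_zero.mpr (by positivity)
    rw [show (Tunnell1983.b n : ℂ) ^ 2 = (Tunnell1983.b n : ℂ) ^ 2 *
      (congruentNumberCurve 10).entireLFunction 1 * (Real.sqrt 5 : ℂ) *
      ((congruentNumberCurve 10).entireLFunction 1 * (Real.sqrt 5 : ℂ))⁻¹ by field_simp, key]
    ring

/-- **`Tunnell1983_waldspurger_chi2`** (Waldspurger's theorem as applied on p. 329, character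
`χ₂`) **from Corollaire 2 and Theorem 2**, through `Tunnell1983_waldspurger_chi2_iff_propto`.
[cite: Waldspurger1981Fourier, Corollaire 2] [cite: Tunnell1983Congruent, pp. 328–329] -/
theorem Tunnell1983_waldspurger_chi2_of_thm2_of_waldspurgerCor (h2 : Tunnell1983_thm2_chi2)
    (hW : ∀ f ∈ tunnellSubspace tunnellChar, ∀ ⦃n₁ n₂ : ℕ⦄, Odd n₁ → Squarefree n₁ →
      Squarefree n₂ → n₁ % 8 = n₂ % 8 →
      (congruentNumberCurve (2 * n₁)).HasEntireLFunction →
      (congruentNumberCurve (2 * n₂)).HasEntireLFunction →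
      qCoeffs f n₁ ^ 2 * (congruentNumberCurve (2 * n₂)).entireLFunction 1 * (Real.sqrt n₂ : ℂ) =
        qCoeffs f n₂ ^ 2 * (congruentNumberCurve (2 * n₁)).entireLFunction 1 *
          (Real.sqrt n₁ : ℂ)) :
    Tunnell1983_waldspurger_chi2 :=
  Tunnell1983_waldspurger_chi2_iff_propto.mpr
    (Tunnell1983_b_sq_propto_L_one_of_thm2_of_waldspurgerCor h2 hW)

/-- **Tunnell's Theorem 3, even twists** (`Tunnell1983_L_one_even`:
`L(E²ᵈ, 1) = b(d)² β / (2 √(2d))` for odd square-free `d`) **from Corollaire 2 and Theorem 2** —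
the two `L`-values `L(E², 1)`, `L(E¹⁰, 1)` and the continuation being theorems of the tree.
[cite: Tunnell1983Congruent, Thm 3 and its proof, p. 329] [cite: Waldspurger1981Fourier, Corollaire 2] -/
theorem Tunnell1983_L_one_even_of_thm2_of_waldspurgerCor (h2 : Tunnell1983_thm2_chi2)
    (hW : ∀ f ∈ tunnellSubspace tunnellChar, ∀ ⦃n₁ n₂ : ℕ⦄, Odd n₁ → Squarefree n₁ →
      Squarefree n₂ → n₁ % 8 = n₂ % 8 →
      (congruentNumberCurve (2 * n₁)).HasEntireLFunction →
      (congruentNumberCurve (2 * n₂)).HasEntireLFunction →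
      qCoeffs f n₁ ^ 2 * (congruentNumberCurve (2 * n₂)).entireLFunction 1 * (Real.sqrt n₂ : ℂ) =
        qCoeffs f n₂ ^ 2 * (congruentNumberCurve (2 * n₁)).entireLFunction 1 *
          (Real.sqrt n₁ : ℂ)) :
    Tunnell1983_L_one_even :=
  Tunnell1983_L_one_even_of_propto (Tunnell1983_b_sq_propto_L_one_of_thm2_of_waldspurgerCor h2 hW)
    BirchSwinnertonDyer1965_L_one_two_ten_holds

/-- **`tunnell_converse_even`** (bsd.S29, converse, even case: under BSD(RANK), the count identity
for even square-free `n` makes `n` congruent) **from Corollaire 2 and Theorem 2.**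
[cite: Tunnell1983Congruent, §3 (p. 330)] [cite: KoblitzECMF1993, Ch. IV §4, Theorem (Tunnell)]
[cite: Waldspurger1981Fourier, Corollaire 2] -/
theorem tunnell_converse_even_of_thm2_of_waldspurgerCor (h2 : Tunnell1983_thm2_chi2)
    (hW : ∀ f ∈ tunnellSubspace tunnellChar, ∀ ⦃n₁ n₂ : ℕ⦄, Odd n₁ → Squarefree n₁ →
      Squarefree n₂ → n₁ % 8 = n₂ % 8 →
      (congruentNumberCurve (2 * n₁)).HasEntireLFunction →
      (congruentNumberCurve (2 * n₂)).HasEntireLFunction →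
      qCoeffs f n₁ ^ 2 * (congruentNumberCurve (2 * n₂)).entireLFunction 1 * (Real.sqrt n₂ : ℂ) =
        qCoeffs f n₂ ^ 2 * (congruentNumberCurve (2 * n₁)).entireLFunction 1 *
          (Real.sqrt n₁ : ℂ)) :
    tunnell_converse_even :=
  tunnell_converse_even_of_propto (Tunnell1983_b_sq_propto_L_one_of_thm2_of_waldspurgerCor h2 hW)

/-! ### Trivial character: `Tunnell1983_a_sq_propto_L_one` from Corollaire 2 and Theorem 2 -/

/-- **Waldspurger's Corollaire 2 at `N = 128`, `k = 3`, `χ = 1`, `φ` of level `32`, combined with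
Tunnell's Theorem 2 (`g θ₂ ∈ S_{3/2}(128, 1, φ)`), gives the displays of p. 329 for `a(n)`**
(`Tunnell1983_a_sq_propto_L_one`, with `c₁ = c₃ = 4/β`). Here `χ₀⁻¹ χ_n = χ₋₄ χ_n` is the
character of `ℚ(√(-n))` and `L(φ ⊗ χ₋ₙ, 1) = L(E⁽⁻ⁿ⁾, 1) = L(Eₙ, 1)` ("`A(t)² = L(φ χ₋₁ χ_t, 1) =
L(Eᵗ, 1)`", p. 329, l. 8), the tree's `entireLFunction 1` of `congruentNumberCurve n` under its
guard. Proof: `f = g θ₂`, pairs `(n, 1)`, `(n, 3)`; `a(1) = 1`, `a(3) = 2`, `L(E₁, 1) ≠ 0`,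
`L(E₃, 1) ≠ 0`. [cite: Waldspurger1981Fourier, Corollaire 2]
[cite: Tunnell1983Congruent, p. 328 (Theorem (Waldspurger)) and p. 329, ll. 7–12] -/
theorem Tunnell1983_a_sq_propto_L_one_of_thm2_of_waldspurgerCor (h2 : Tunnell1983_thm2_triv)
    (hW : ∀ f ∈ tunnellSubspace 1, ∀ ⦃n₁ n₂ : ℕ⦄, Odd n₁ → Squarefree n₁ →
      Squarefree n₂ → n₁ % 8 = n₂ % 8 →
      (congruentNumberCurve n₁).HasEntireLFunction → (congruentNumberCurve n₂).HasEntireLFunction →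
      qCoeffs f n₁ ^ 2 * (congruentNumberCurve n₂).entireLFunction 1 * (Real.sqrt n₂ : ℂ) =
        qCoeffs f n₂ ^ 2 * (congruentNumberCurve n₁).entireLFunction 1 * (Real.sqrt n₁ : ℂ)) :
    Tunnell1983_a_sq_propto_L_one := by
  have hL1 := entireLFunction_congruentNumberCurve_one_one_ne_zero
  have hL3 := entireLFunction_congruentNumberCurve_three_one_ne_zero
  refine ⟨((congruentNumberCurve 1).entireLFunction 1)⁻¹,
    4 * ((congruentNumberCurve 3).entireLFunction 1 * (Real.sqrt 3 : ℂ))⁻¹, fun n hn hL ↦ ⟨?_, ?_⟩⟩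
  · intro h1
    have hodd : Odd n := Nat.odd_iff.mpr (by omega)
    have key := hW (tunnellForm 2) h2.1 hodd hn squarefree_one (by omega) hL
      (hasEntireLFunction_congruentNumberCurve_holds squarefree_one)
    rw [qCoeffs_tunnellForm_two_of_odd hodd, qCoeffs_tunnellForm_two_of_odd odd_one, a_one,
      Nat.cast_one, Real.sqrt_one] at key
    push_cast at key
    rw [one_pow, one_mul, mul_one] at key
    rw [mul_assoc, ← key]
    field_simp
  · intro h3
    have hodd : Odd n := Nat.odd_iff.mpr (by omega)
    have key := hW (tunnellForm 2) h2.1 hodd hn Nat.prime_three.prime.squarefree (by omega)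
      hL (hasEntireLFunction_congruentNumberCurve_holds Nat.prime_three.prime.squarefree)
    rw [qCoeffs_tunnellForm_two_of_odd hodd, qCoeffs_tunnellForm_two_of_odd (by decide),
      a_three] at key
    push_cast at key
    have hs3 : (Real.sqrt 3 : ℂ) ≠ 0 := Complex.ofReal_ne_zero.mpr (by positivity)
    rw [show (Tunnell1983.a n : ℂ) ^ 2 = (Tunnell1983.a n : ℂ) ^ 2 *
      (congruentNumberCurve 3).entireLFunction 1 * (Real.sqrt 3 : ℂ) *
      ((congruentNumberCurve 3).entireLFunction 1 * (Real.sqrt 3 : ℂ))⁻¹ by field_simp, key]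
    ring

/-- **`Tunnell1983_waldspurger_triv`** (Waldspurger's theorem as applied on p. 329, trivial
character) **from Corollaire 2 and Theorem 2**, through `Tunnell1983_waldspurger_triv_iff_propto`.
[cite: Waldspurger1981Fourier, Corollaire 2] [cite: Tunnell1983Congruent, pp. 328–329] -/
theorem Tunnell1983_waldspurger_triv_of_thm2_of_waldspurgerCor (h2 : Tunnell1983_thm2_triv)
    (hW : ∀ f ∈ tunnellSubspace 1, ∀ ⦃n₁ n₂ : ℕ⦄, Odd n₁ → Squarefree n₁ →
      Squarefree n₂ → n₁ % 8 = n₂ % 8 →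
      (congruentNumberCurve n₁).HasEntireLFunction → (congruentNumberCurve n₂).HasEntireLFunction →
      qCoeffs f n₁ ^ 2 * (congruentNumberCurve n₂).entireLFunction 1 * (Real.sqrt n₂ : ℂ) =
        qCoeffs f n₂ ^ 2 * (congruentNumberCurve n₁).entireLFunction 1 * (Real.sqrt n₁ : ℂ)) :
    Tunnell1983_waldspurger_triv :=
  Tunnell1983_waldspurger_triv_iff_propto.mpr
    (Tunnell1983_a_sq_propto_L_one_of_thm2_of_waldspurgerCor h2 hW)

/-- **Tunnell's Theorem 3, odd twists** (`Tunnell1983_L_one_odd`: `L(Eᵈ, 1) = a(d)² β / (4 √d)`)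
**from Corollaire 2 and Theorem 2** (`L(E₁, 1)`, `L(E₃, 1)` and the continuation from the tree).
[cite: Tunnell1983Congruent, Thm 3 and its proof, p. 329] [cite: Waldspurger1981Fourier, Corollaire 2] -/
theorem Tunnell1983_L_one_odd_of_thm2_of_waldspurgerCor (h2 : Tunnell1983_thm2_triv)
    (hW : ∀ f ∈ tunnellSubspace 1, ∀ ⦃n₁ n₂ : ℕ⦄, Odd n₁ → Squarefree n₁ →
      Squarefree n₂ → n₁ % 8 = n₂ % 8 →
      (congruentNumberCurve n₁).HasEntireLFunction → (congruentNumberCurve n₂).HasEntireLFunction →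
      qCoeffs f n₁ ^ 2 * (congruentNumberCurve n₂).entireLFunction 1 * (Real.sqrt n₂ : ℂ) =
        qCoeffs f n₂ ^ 2 * (congruentNumberCurve n₁).entireLFunction 1 * (Real.sqrt n₁ : ℂ)) :
    Tunnell1983_L_one_odd :=
  Tunnell1983_L_one_odd_of_propto (Tunnell1983_a_sq_propto_L_one_of_thm2_of_waldspurgerCor h2 hW)
    BirchSwinnertonDyer1965_L_one_one_three_holds

/-- **`tunnell_converse_odd`** (bsd.S29, converse, odd case) **from Corollaire 2 and Theorem 2.**
[cite: Tunnell1983Congruent, §3 (p. 330)] [cite: KoblitzECMF1993, Ch. IV §4, Theorem (Tunnell)]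
[cite: Waldspurger1981Fourier, Corollaire 2] -/
theorem tunnell_converse_odd_of_thm2_of_waldspurgerCor (h2 : Tunnell1983_thm2_triv)
    (hW : ∀ f ∈ tunnellSubspace 1, ∀ ⦃n₁ n₂ : ℕ⦄, Odd n₁ → Squarefree n₁ →
      Squarefree n₂ → n₁ % 8 = n₂ % 8 →
      (congruentNumberCurve n₁).HasEntireLFunction → (congruentNumberCurve n₂).HasEntireLFunction →
      qCoeffs f n₁ ^ 2 * (congruentNumberCurve n₂).entireLFunction 1 * (Real.sqrt n₂ : ℂ) =
        qCoeffs f n₂ ^ 2 * (congruentNumberCurve n₁).entireLFunction 1 * (Real.sqrt n₁ : ℂ)) :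
    tunnell_converse_odd :=
  tunnell_converse_odd_of_propto (Tunnell1983_a_sq_propto_L_one_of_thm2_of_waldspurgerCor h2 hW)

end Literature.NumberTheory.EllipticCurves

end
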